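/-
COR-CM (cell pub-hodgecm2, stage 2 of the Hodge ladder) — count-neutral KERNEL COMBINATORICS «field level of the QUATERNION-DOUBLING law: a Galois CM
field of degree 16 with Galois group Q₈ × ℤ/2 (complex conjugation (−1, 0)) or the Pauli group Q₈ ∘ ℤ/4 (complex conjugation z²) has EXACTLY φ₂(F) =
18, resp. 20, generating faces» (seat prover-pub-hodgecm2-b23-g54-0, binder prover b23, gen 54; claim HOME/INBOX.md l.25095, NAME ACK lead gen 22 —
stem `CorCM/FaceQuaternionDoubling*`).  Theorems only; `Census/QuaternionDoublingLaw.lean` (this seat), the field transfer `CorCM/FaceGenerationTransfer.lean`,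
`galTOfAut` (`CorCM/FaceCensusOddSliceTransport.lean`) and the INT2-GEN socket are used BY NAME; nothing asserted.  `Interfaces.lean` (C1), every E term,
B01, `Transposition/*`, `PortJoin/*`, `D2Bridge/*` untouched.
HONEST FRAMING: `HC_CM` is NOT proved, here or anywhere in the tree; this file produces no period and proves no face period for any field; §3 is CONDITIONAL
on the face periods exactly as the earlier sockets.
T5: n/a-class (hypothesis binders: a quaternion doubling datum on the Galois translates, resp. the `Aut`-datum of §2 with `[F:ℚ] = 16` — inhabited by
the Galois CM fields with group `Q₈ × ℤ/2` (e.g. a quaternion octic CM field times a real quadratic field) and by the Pauli CM fields; checker: self, 2026-08-25).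
-/
import Summits.HodgeConjecture.CorCM.Census.QuaternionDoublingLaw
import Summits.HodgeConjecture.CorCM.FaceGenerationTransfer
import Summits.HodgeConjecture.CorCM.FaceCensusOddSliceTransport
import HarnessLib

/-!
# Field level of the quaternion-doubling law: Galois CM fields of degree `16` with group `Q₈ × ℤ/2` or the Pauli group

**`isLeast_card_faces_hgen_of_quaternionDoubling`**: a Galois CM field `F` whose Galois translates carry a quaternion doubling datum
(`QuaternionDoubling.Datum (GalT F) conjT τ`: `Gal(F/ℚ) ≅ Q₈ × ℤ/2` with complex conjugation `(−1, 0)` for `τ = 0`, `Gal(F/ℚ) ≅ Q₈ ∘ ℤ/4` (the Pauli group)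
with complex conjugation the square of the centre for `τ = 1`) has EXACTLY `φ₂(F)` generating faces — the rows **`18`** (`τ = 0`, `= β(F)`) and **`20`**
(`τ = 1`, `= β(F) − 2`).  §2 builds the datum from automorphisms `i₀, j₀, x₀` of `F` (`exists_datum_of_aut`), §3 is the CONDITIONAL Hodge-conjecture
reading through the INT2-GEN socket.  With seat b09 gen 46ʼs dihedral kernel-two law (`D₄ × ℤ/2`, `G(16,3)`, `ℤ/4 ⋊ ℤ/4`), gen 50ʼs capstone (the four
groups with a cyclic subgroup of index two) and the abelian ∕ complemented laws, these were the last two open rows of degree `16`.  `HC_CM` is NOT proved.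

## References
* [Pohlmann1968] H. Pohlmann, Algebraic cycles on abelian varieties of complex multiplication type, Ann. of Math. 88 (1968), Thm 1.
* [Shimura1998] G. Shimura, Abelian Varieties with Complex Multiplication and Modular Functions, §6.2 Thm. 3, §8.1.
-/

noncomputable section

open CategoryTheory NumberField NumberField.ComplexEmbedding
open Literature.AlgebraicGeometry Literature.AlgebraicGeometry.Motives Literature.AlgebraicGeometry.HodgeTheory
open Literature.AlgebraicGeometry.ComplexMultiplication Literature.AlgebraicGeometry.Milne1999
open Literature.NumberTheory.Automorphic
open Literature.NumberTheory.Automorphic.PicardCM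
open Summit.HodgeConjecture.CorCM.Domination

namespace Summit.HodgeConjecture.CorCM.FaceQuaternionDoubling

open Summit.HodgeConjecture.CorCM.Prior.AllgGroup.RfwfAllgGroup
open Summit.HodgeConjecture.CorCM.Census.BlockParity
open Summit.HodgeConjecture.CorCM.Census.Coinvariant
open Summit.HodgeConjecture.CorCM.Census
open Summit.HodgeConjecture.CorCM.FaceCensus.OddSlice (galTOfAut galTOfAut_mul galTOfAut_conjAut)

section Field

variable {F : Type} [Field F] [NumberField F] {τ : ZMod 2}

/-! ## §1 Exactly `φ₂(F)` generating faces -/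

/-- **A QUATERNION DOUBLING DATUM IN THE GALOIS TRANSLATES ⟹ EXACTLY `φ₂(F)` GENERATING FACES** (`Gal(F/ℚ) ≅ Q₈ × ℤ/2` with conjugation
`(−1, 0)`, or the Pauli group with conjugation `z²`). [folklore] -/
theorem isLeast_card_faces_hgen_of_quaternionDoubling [IsCMField F] [IsGalois ℚ F] (D : QuaternionDoubling.Datum (GalT F) conjT τ)
    (σ₀ : F →+* ℂ) :
    IsLeast {n : ℕ | ∃ 𝒮 : Finset (Face F), 𝒮.card = n ∧
      ∀ f : Face F, lefChar f.corner (fun _ => ({σ₀} : Finset (F →+* ℂ))) ∈ AddSubgroup.closure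
        {a : Asym F | ∃ g ∈ (𝒮 : Set (Face F)), ∃ σ : F →+* ℂ, a = lefChar g.corner (fun _ => ({σ} : Finset (F →+* ℂ)))}}
      (fibreTwo (conjT : GalT F) conjT_mul_self) := by
  refine FaceTransfer.isLeast_card_faces_hgen_of_intrinsic _ ?_ (fun S₀ hS₀ hS => ?_) σ₀
  · obtain ⟨S, hS, hcard, hgen⟩ := D.isLeast_card_gfaces_generate_fibreTwo.1
    exact ⟨S, hS, hcard.le, hgen⟩
  · exact fibreTwo_le_card conjT conjT_mul_self FaceBasis.conjT_comm S₀ (Submodule.span ℤ (pairSet conjT)) le_rfl hS₀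
      (fun y hy => hS (gfaceSet_subset_hodgeSpan conjT conjT_mul_self hy))

/-- **THE ROW `Q₈ × ℤ/2` AT THE FIELD LEVEL: EXACTLY `18` GENERATING FACES** (`= β(F) = 18`). [folklore] -/
theorem isLeast_card_faces_hgen_eighteen [IsCMField F] [IsGalois ℚ F] (D : QuaternionDoubling.Datum (GalT F) conjT 0) (σ₀ : F →+* ℂ) :
    IsLeast {n : ℕ | ∃ 𝒮 : Finset (Face F), 𝒮.card = n ∧
      ∀ f : Face F, lefChar f.corner (fun _ => ({σ₀} : Finset (F →+* ℂ))) ∈ AddSubgroup.closure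
        {a : Asym F | ∃ g ∈ (𝒮 : Set (Face F)), ∃ σ : F →+* ℂ, a = lefChar g.corner (fun _ => ({σ} : Finset (F →+* ℂ)))}} 18 ∧
    Fintype.card (Block (conjT : GalT F)) = 18 := by
  have h := isLeast_card_faces_hgen_of_quaternionDoubling D σ₀
  rw [D.isLeast_card_gfaces_generate_fibreTwo_zero.2.1] at h
  exact ⟨h, D.isLeast_card_gfaces_generate_fibreTwo_zero.2.2.1⟩

/-- **THE ROW PAULI AT THE FIELD LEVEL: EXACTLY `20` GENERATING FACES** (`= β(F) − 2`, `β(F) = 22`). [folklore] -/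
theorem isLeast_card_faces_hgen_twenty [IsCMField F] [IsGalois ℚ F] (D : QuaternionDoubling.Datum (GalT F) conjT 1) (σ₀ : F →+* ℂ) :
    IsLeast {n : ℕ | ∃ 𝒮 : Finset (Face F), 𝒮.card = n ∧
      ∀ f : Face F, lefChar f.corner (fun _ => ({σ₀} : Finset (F →+* ℂ))) ∈ AddSubgroup.closure
        {a : Asym F | ∃ g ∈ (𝒮 : Set (Face F)), ∃ σ : F →+* ℂ, a = lefChar g.corner (fun _ => ({σ} : Finset (F →+* ℂ)))}} 20 ∧
    Fintype.card (Block (conjT : GalT F)) = 22 := by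
  have h := isLeast_card_faces_hgen_of_quaternionDoubling D σ₀
  rw [D.isLeast_card_gfaces_generate_fibreTwo_one.2.1] at h
  exact ⟨h, D.isLeast_card_gfaces_generate_fibreTwo_one.2.2.1⟩

/-! ## §2 The datum from automorphisms -/

/-- **The quaternion doubling datum from an `Aut`-datum.**  Automorphisms `i₀` (order `4`, `i₀²` inducing complex conjugation at `σ₀`), `j₀`
(`j₀² = i₀²`, `j₀ i₀ j₀⁻¹ = i₀⁻¹`, not a power of `i₀`) and an involution `x₀` with `x₀ i₀ x₀ = i₀^{1+2t}`, `x₀ j₀ x₀ = i₀^{2t} j₀` (`t = 0`: `x₀` commutes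
with `i₀, j₀`; `t = 1`: `x₀` inverts them), `x₀ ≠ i₀ᵘ j₀ᵛ`, in a field of degree `16`, give a datum on `GalT F` with complex conjugation `conjT`. [folklore] -/
theorem exists_datum_of_aut [IsGalois ℚ F] (σ₀ : F →+* ℂ) (i₀ j₀ x₀ : F ≃ₐ[ℚ] F) {t : ℕ} (ht : t < 2) (hord : orderOf i₀ = 4)
    (hcσ : σ₀.comp ((i₀ * i₀ : F ≃ₐ[ℚ] F) : F →+* F) = conjugate σ₀) (hjj : j₀ * j₀ = i₀ * i₀) (hji : j₀ * i₀ * j₀⁻¹ = i₀⁻¹)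
    (hj : j₀ ∉ Subgroup.zpowers i₀) (hx2 : x₀ * x₀ = 1) (hxi : x₀ * i₀ * x₀ = i₀ ^ (1 + 2 * t)) (hxj : x₀ * j₀ * x₀ = i₀ ^ (2 * t) * j₀)
    (hx : ∀ u v : ℕ, x₀ ≠ i₀ ^ u * j₀ ^ v) (hdeg : Module.finrank ℚ F = 16) :
    Nonempty (QuaternionDoubling.Datum (GalT F) conjT (t : ZMod 2)) := by
  set e : (F ≃ₐ[ℚ] F) ≃* GalT F := MulEquiv.mk' (galTOfAut σ₀) (galTOfAut_mul σ₀) with he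
  have he_apply : ∀ y, e y = galTOfAut σ₀ y := fun y => rfl
  have hmem : ∀ y : F ≃ₐ[ℚ] F, e y ∈ Subgroup.zpowers (e i₀) ↔ y ∈ Subgroup.zpowers i₀ := by
    intro y
    constructor
    · intro h
      obtain ⟨k, hk⟩ := Subgroup.mem_zpowers_iff.mp h
      rw [← map_zpow, e.apply_eq_iff_eq] at hk
      exact Subgroup.mem_zpowers_iff.mpr ⟨k, hk⟩
    · intro h
      obtain ⟨k, hk⟩ := Subgroup.mem_zpowers_iff.mp h
      exact Subgroup.mem_zpowers_iff.mpr ⟨k, by rw [← map_zpow, hk]⟩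
  have hord' : orderOf (e i₀) = 4 := by rw [← hord]; exact orderOf_injective e.toMonoidHom e.injective i₀
  have hcard : Nat.card (GalT F) = 16 := by rw [Nat.card_eq_fintype_card, FaceCensus.card_galT, hdeg]
  have hii' : e i₀ * e i₀ = conjT := by rw [← map_mul, he_apply]; exact galTOfAut_conjAut σ₀ hcσ
  have hjj' : e j₀ * e j₀ = conjT := by rw [← map_mul, hjj, map_mul, hii']
  have hji' : e j₀ * e i₀ * (e j₀)⁻¹ = (e i₀)⁻¹ := by rw [← map_mul, ← map_inv, ← map_mul, hji, map_inv]
  have hj' : e j₀ ∉ Subgroup.zpowers (e i₀) := fun h => hj ((hmem j₀).mp h)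
  have hx2' : e x₀ * e x₀ = 1 := by rw [← map_mul, hx2, map_one]
  have hpow : e i₀ ^ (2 * t) = QuaternionDoubling.cpow conjT (t : ZMod 2) := by
    unfold QuaternionDoubling.cpow
    interval_cases t
    · simp
    · rw [show 2 * 1 = 2 by rfl, pow_two, hii']; simp
  have hxi' : e x₀ * e i₀ * e x₀ = QuaternionDoubling.cpow conjT (t : ZMod 2) * e i₀ := by
    rw [← map_mul, ← map_mul, hxi, map_pow, pow_add, pow_one, hpow]
    unfold QuaternionDoubling.cpow
    split_ifs
    · rw [one_mul, mul_one]
    · rw [← hii', mul_assoc]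
  have hxj' : e x₀ * e j₀ * e x₀ = QuaternionDoubling.cpow conjT (t : ZMod 2) * e j₀ := by
    rw [← map_mul, ← map_mul, hxj, map_mul, map_pow, hpow]
  have hx' : ∀ u v : ℕ, e x₀ ≠ e i₀ ^ u * e j₀ ^ v := by
    intro u v h
    apply hx u v
    rw [← map_pow, ← map_pow, ← map_mul, e.apply_eq_iff_eq] at h
    exact h
  exact ⟨⟨e i₀, e j₀, e x₀, hord', hii', hjj', hji', hj', hx2', hxi', hxj', hx', hcard⟩⟩

/-- **EXACTLY `φ₂(F)` GENERATING FACES FROM AN `Aut`-DATUM** (degree `16`, group `Q₈ × ℤ/2` or Pauli as in `exists_datum_of_aut`). [folklore] -/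
theorem isLeast_card_faces_hgen_of_aut [IsCMField F] [IsGalois ℚ F] (σ₀ : F →+* ℂ) (i₀ j₀ x₀ : F ≃ₐ[ℚ] F) {t : ℕ} (ht : t < 2)
    (hord : orderOf i₀ = 4) (hcσ : σ₀.comp ((i₀ * i₀ : F ≃ₐ[ℚ] F) : F →+* F) = conjugate σ₀) (hjj : j₀ * j₀ = i₀ * i₀)
    (hji : j₀ * i₀ * j₀⁻¹ = i₀⁻¹) (hj : j₀ ∉ Subgroup.zpowers i₀) (hx2 : x₀ * x₀ = 1) (hxi : x₀ * i₀ * x₀ = i₀ ^ (1 + 2 * t))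
    (hxj : x₀ * j₀ * x₀ = i₀ ^ (2 * t) * j₀) (hx : ∀ u v : ℕ, x₀ ≠ i₀ ^ u * j₀ ^ v) (hdeg : Module.finrank ℚ F = 16) :
    IsLeast {n : ℕ | ∃ 𝒮 : Finset (Face F), 𝒮.card = n ∧
      ∀ f : Face F, lefChar f.corner (fun _ => ({σ₀} : Finset (F →+* ℂ))) ∈ AddSubgroup.closure
        {a : Asym F | ∃ g ∈ (𝒮 : Set (Face F)), ∃ σ : F →+* ℂ, a = lefChar g.corner (fun _ => ({σ} : Finset (F →+* ℂ)))}}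
      (fibreTwo (conjT : GalT F) conjT_mul_self) := by
  obtain ⟨D⟩ := exists_datum_of_aut σ₀ i₀ j₀ x₀ ht hord hcσ hjj hji hj hx2 hxi hxj hx hdeg
  exact isLeast_card_faces_hgen_of_quaternionDoubling D σ₀

end Field

/-! ## §3 The conditional Hodge-conjecture reading -/

/-- **HC for the slice of a Galois CM field with group `Q₈ × ℤ/2` (conjugation `(−1,0)`) or the Pauli group (conjugation `z²`), from `φ₂(K) = 18`,
resp. `20`, face periods** (CONDITIONAL; `HC_CM` is NOT proved).
[cite: Shimura1998, §6.2 Theorem 3 and §6.1 Corollary of Theorem 2 (pp. 41–43)] [cite: Pohlmann1968, Thm. 1]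
[cite: Milne1999LefschetzClasses, Thm. 3.2 and Cor. 4.5] [cite: MumfordAV1970, §19 Thm. 1 and p. 169] -/
theorem hodgeConjectureFor_of_quaternionDoubling_of_exists_facePeriod (K : CMField) [hGal : IsGalois ℚ K] (σ₀ : (K : Type) →+* ℂ)
    {τ : ZMod 2} (D : QuaternionDoubling.Datum (GalT K) conjT τ) :
    ∃ 𝒮 : Finset (Face K), 𝒮.card = fibreTwo (conjT : GalT K) conjT_mul_self ∧
      ((∀ f ∈ 𝒮, ∃ ι₁ : K →+* ℂ, f.Admissible ι₁ ∧ ∃ (V : HermSpace3 K ι₁) (σ : K →+* ℂ),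
        (Model.picardCMUniverse exists_isReal_hodgeModel_holds hodgePQ_independent_of_hodgeModel_holds
          BallQuotient.ballQuotientUniformised_holds cmAbelianVarietyRealised_holds).PeriodNV ι₁ V K f.psi σ) →
      ∀ {P B : AbelianVariety ℂ}, AbelianVariety.IsProductOf (fun B : AbelianVariety ℂ =>
        ∃ (E : Type) (_ : Field E) (_ : NumberField E) (_ : IsCMField E) (_ : E →+* (K : Type)) (Φ : CMType E)
          (ι : 𝓞 E →+* End B) (ϑ : E →+* Module.End ℂ (complexBetti B.X 1)),
          IsCMTypeRealisation Φ B ι ϑ) P →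
      AVDominatedBy B P → HodgeConjectureFor B.dim B.X) := by
  obtain ⟨⟨𝒮, hcard, hgen⟩, -⟩ := isLeast_card_faces_hgen_of_quaternionDoubling (F := K) D σ₀
  refine ⟨𝒮, hcard, fun h P B hP hB => ?_⟩
  have h6 : 6 ≤ Module.finrank ℚ K := by rw [← FaceCensus.card_galT (F := K), ← Nat.card_eq_fintype_card, D.hcard]; omega
  exact hodgeConjectureFor_of_avDominatedBy_isProductOf_of_exists_facePeriod_on K h6 (𝒮 : Set (Face K)) σ₀ hgen
    (fun f hf => h f (Finset.mem_coe.mp hf)) hP hB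

end Summit.HodgeConjecture.CorCM.FaceQuaternionDoubling
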